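import Mathlib
import Summits.KontsevichZagierPeriods.Zeta5Search.Profile16aCellsA
import Summits.KontsevichZagierPeriods.Zeta5Search.Profile16aCellsB
import Summits.KontsevichZagierPeriods.Zeta5Search.DenomLaw.Profile16cPath
import Summits.KontsevichZagierPeriods.Zeta5Search.DenomLaw.L5Depth8CoverKit
import Summits.KontsevichZagierPeriods.Zeta5Search.LawA4Proof
import HarnessLib

/-!
# ζ(5) search — the `N_p = 16` PROFILE with short blocks `(1,2), …, (1,6)` for EVERY sorted parameter vector: THEOREM A⁗ `−9` and THEOREM L5₈ `−8` in the frame `(8, [1,−5,−5,1])` ⇒ PATH accounting below `d = 3p`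

Cell `pub-zeta5` (HONEST FRAMING: systematic search; no irrationality claim unless certified), TRACK «DENOM-LAW» D1 prover seat
(denom-prover-d1 g18, `HOME/denom-law/prover-d1/ATTEMPT-18.md` §2, §4).  Tenth general-`b` profile of the first period: the `N_p = 16` branch whose short blocks are
`(1,2),…,(1,6)` — `p ≤ b₇`, `b₀ − b₁ − b₆ < p ≤ min(b₀ − b₁ − b₇, b₀ − b₂ − b₃)` inside the first period.  Then `N_p = 16` (`pairFloors_eq_16a`), `C⋆ ≤ 11`, `p < d < 4p`
(`d_bounds16a`), and the node `DenomLaw.PathAccountingFirstPeriod` asks `⌊d/p⌋ − 10`.  The machine-generated covers `FullProfile.cover16a_ev / cover16a_od`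
(`Profile16aCells{A,B}`, 24 / 23 types; deep class the centre-free palindrome `[1,−5,−5,1]` at `−8`) pass ALL SIX clauses of gen 3's `DenomLaw.checkL5` in the frame
`(8, [1,−5,−5,1])` (`decide`), so THEOREM A⁗ (`lawA4_apply lawA4_holds` through `clausesL5_of_cover`) gives **`−9 = 7 − 2M` on the whole profile** (`cas_ge16a_neg9`) and,
at `2p ≤ d` (degree condition `4p ≤ 2d + 1`), THEOREM L5 AT FRAME DEPTH 8 (`SecondOrder.lawA5_depth8` through gen 18's `DenomLaw.lawA5d8_of_cover`: all parameters
long, so every single-pole class of `b` and of `b + e_j` has exponent `≥ −4`) gives **`−8 = 8 − 2M`** (`cas_ge16a_neg8`) — the node's values at `⌊d/p⌋ = 1, 2`: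
**`pathAccounting_profile16a`** / **`pathAccountingFirstPeriod_profile16a`** (binders VERBATIM plus the profile inequalities and `d < 3p`), (CV) on the whole profile
(`profile16aCV`).  OPEN: `3p ≤ d` (node `−7 = 9 − 2M`; census: 26 of 2,529 instances at `p ≤ 11` — the «L6» corner of this profile).  Census beside the proof
(`g18/code/profile_census.py`, exhaustive `p ≤ 11`): A⁗ 680 / 680 at `⌊d/p⌋ = 1`, L5₈ 1,823 / 1,823 at `⌊d/p⌋ = 2`.
MODEL/structure-side valuation bookkeeping of the cell's own rationals; nothing about ζ(5); no γ; records in print UNMOVED.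
-/

open Finset

namespace Summit.KontsevichZagierPeriods.Zeta5Search.FullProfile

open Summit.KontsevichZagierPeriods.Zeta5Search.ClusterValuation
open Summit.KontsevichZagierPeriods.Zeta5Search.CasoratianValuation (InPolytope shift casoratian pairFloors refund)
open Summit.KontsevichZagierPeriods.Zeta5Search.WedgeDictionary (dOf)
open Summit.KontsevichZagierPeriods.Zeta5Search.ClassTypeCover
open Summit.KontsevichZagierPeriods.Zeta5Search.DenomLaw (cStar FirstPeriod Sorted7 clausesL5_of_cover lawA5d8_of_cover)
open Summit.KontsevichZagierPeriods.Zeta5Search.DenomLaw.FirstPeriodKit (cStar_le_eleven sorted7_chain firstPeriod_pair pairFloors_expand)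
open Summit.KontsevichZagierPeriods.Zeta5Search.RecordWindowsA4 (lawA4_apply)
open Summit.KontsevichZagierPeriods.Zeta5Search.SecondOrder (lawA4_holds)
open Summit.KontsevichZagierPeriods.Zeta5Search.SortedProfile

section Bounds

variable {b : ℕ → ℤ} {j p : ℕ}

/-- On this profile `p < d(b) < 4p` (lower: `d + b₄ = (b₀−b₁−b₇)+(b₀−b₂−b₆)+(b₀−b₃−b₅) ≥ 3p`, `b₄ ≤ b₁ < 2p`; upper: `3b₀ < 3p + 3b₁ + 3b₆`). -/
theorem d_bounds16a (hs : Sorted7 b) (hP : (p : ℤ) ≤ b 7) (hQ : b 0 < (p : ℤ) + b 1 + b 6) (hQ7 : (p : ℤ) + b 1 + b 7 ≤ b 0) (hQ23 : (p : ℤ) + b 2 + b 3 ≤ b 0) (hF1 : b 1 < 2 * (p : ℤ)) :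
    (p : ℤ) < dOf b ∧ dOf b < 4 * (p : ℤ) := by
  obtain ⟨h21, h32, h43, h54, h65, h76⟩ := sorted7_chain hs
  rw [DecompositionWholeCone.dOf_expand]; constructor <;> linarith

/-- **`N_p = 16`** on this profile: the pair digits of `(1,2), …, (1,6)` are `0`, the other sixteen are `1`. -/
theorem pairFloors_eq_16a (hb : InPolytope b) (hs : Sorted7 b) (hp : 0 < p) (hQ : b 0 < (p : ℤ) + b 1 + b 6) (hQ7 : (p : ℤ) + b 1 + b 7 ≤ b 0) (hQ23 : (p : ℤ) + b 2 + b 3 ≤ b 0) (hfp : FirstPeriod b p) : pairFloors b p = 16 := by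
  obtain ⟨h21, h32, h43, h54, h65, h76⟩ := sorted7_chain hs
  obtain ⟨h0, hb1, hb2, hb3, hb4, -, -, -, hc1⟩ := box hb
  have hp0 : (0 : ℤ) < p := by exact_mod_cast hp
  have one : ∀ z : ℤ, (p : ℤ) ≤ z → z ≤ 2 * (p : ℤ) - 1 → z / (p : ℤ) = 1 := fun z h1 h2 => by
    rw [Int.ediv_eq_iff_of_pos hp0]; constructor <;> linarith
  have z12 : (b 0 - b 1 - b 2) / (p : ℤ) = 0 := Int.ediv_eq_zero_of_lt (by linarith) (by linarith)
  have z13 : (b 0 - b 1 - b 3) / (p : ℤ) = 0 := Int.ediv_eq_zero_of_lt (by linarith) (by linarith)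
  have z14 : (b 0 - b 1 - b 4) / (p : ℤ) = 0 := Int.ediv_eq_zero_of_lt (by linarith) (by linarith)
  have z15 : (b 0 - b 1 - b 5) / (p : ℤ) = 0 := Int.ediv_eq_zero_of_lt (by linarith) (by linarith)
  have z16 : (b 0 - b 1 - b 6) / (p : ℤ) = 0 := Int.ediv_eq_zero_of_lt (by linarith) (by linarith)
  have U := fun (i k : ℕ) (hi : i < 7) (hk : k < 7) (hik : i < k) => firstPeriod_pair hfp hi hk hik
  rw [pairFloors_expand, z12, z13, z14, z15, z16,
    one _ (by linarith) (U 0 6 (by norm_num) (by norm_num) (by norm_num)), one _ (by linarith) (U 1 2 (by norm_num) (by norm_num) (by norm_num)),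
    one _ (by linarith) (U 1 3 (by norm_num) (by norm_num) (by norm_num)), one _ (by linarith) (U 1 4 (by norm_num) (by norm_num) (by norm_num)),
    one _ (by linarith) (U 1 5 (by norm_num) (by norm_num) (by norm_num)), one _ (by linarith) (U 1 6 (by norm_num) (by norm_num) (by norm_num)),
    one _ (by linarith) (U 2 3 (by norm_num) (by norm_num) (by norm_num)), one _ (by linarith) (U 2 4 (by norm_num) (by norm_num) (by norm_num)),
    one _ (by linarith) (U 2 5 (by norm_num) (by norm_num) (by norm_num)), one _ (by linarith) (U 2 6 (by norm_num) (by norm_num) (by norm_num)),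
    one _ (by linarith) (U 3 4 (by norm_num) (by norm_num) (by norm_num)), one _ (by linarith) (U 3 5 (by norm_num) (by norm_num) (by norm_num)),
    one _ (by linarith) (U 3 6 (by norm_num) (by norm_num) (by norm_num)), one _ (by linarith) (U 4 5 (by norm_num) (by norm_num) (by norm_num)),
    one _ (by linarith) (U 4 6 (by norm_num) (by norm_num) (by norm_num)), one _ (by linarith) (U 5 6 (by norm_num) (by norm_num) (by norm_num))]
  norm_num

/-- **THEOREM A⁗ on this profile, general `b`**: `v_p(Cas_j(b)) ≥ −9 = 7 − 2M` in the frame `(8, [1,−5,−5,1])` (all six clauses of `checkL5` hold on both covers; only the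
five class clauses are used here). -/
theorem cas_ge16a_neg9 (hb : InPolytope b) (hs : Sorted7 b) (hbj : InPolytope (shift b j)) (hj1 : 1 ≤ j) (hj7 : j ≤ 7)
    (hprime : p.Prime) (hp5 : 5 ≤ p) (hwin : (b 0 + 2 : ℤ) < (p : ℤ) ^ 2) (hP : (p : ℤ) ≤ b 7) (hQ : b 0 < (p : ℤ) + b 1 + b 6) (hQ7 : (p : ℤ) + b 1 + b 7 ≤ b 0) (hQ23 : (p : ℤ) + b 2 + b 3 ≤ b 0)
    (hF1 : b 1 < 2 * (p : ℤ)) (hF2 : b 0 < 2 * (p : ℤ) + b 6 + b 7) (hcas : casoratian b j ≠ 0) : (-9 : ℤ) ≤ padicValRat p (casoratian b j) := by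
  haveI : Fact p.Prime := ⟨hprime⟩
  have hp2 : p % 2 = 1 := Nat.odd_iff.1 (hprime.odd_of_ne_two (by omega))
  obtain ⟨h0, hb1, hb2, hb3, hb4, -, -, -, -⟩ := box hb
  have hpb : (p : ℤ) ≤ b 0 := by linarith
  have hT : ([1, -5, -5, 1] : List ℤ).reverse = [1, -5, -5, 1] := by decide
  rcases Int.emod_two_eq_zero_or_one (b 0) with hr | hr
  · obtain ⟨hC, -⟩ := clausesL5_of_cover (cover16a_ev hb hs hP hQ hQ7 hQ23 hF1 hF2 hp5 hp2 hr) (M := 8) (T := [1, -5, -5, 1])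
      (by rw [oddFlag_false hr]; decide)
    have h := lawA4_apply lawA4_holds _ p j 8 [1, -5, -5, 1] hb hbj hj1 hj7 hprime hp5 hpb hwin (by norm_num) (by decide) hT hC hcas
    push_cast at h; linarith
  · obtain ⟨hC, -⟩ := clausesL5_of_cover (cover16a_od hb hs hP hQ hQ7 hQ23 hF1 hF2 hp5 hp2 hr) (M := 8) (T := [1, -5, -5, 1])
      (by rw [oddFlag_true hr]; decide)
    have h := lawA4_apply lawA4_holds _ p j 8 [1, -5, -5, 1] hb hbj hj1 hj7 hprime hp5 hpb hwin (by norm_num) (by decide) hT hC hcas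
    push_cast at h; linarith

/-- **THEOREM L5₈ on this profile at `2p ≤ d`, general `b`**: `v_p(Cas_j(b)) ≥ −8 = 8 − 2M` (frame `(8, [1,−5,−5,1])`, degree condition `4p ≤ 2d + 1`; all parameters
long, so the single-pole side condition of `lawA5_depth8` holds for `b` and `b + e_j`). -/
theorem cas_ge16a_neg8 (hb : InPolytope b) (hs : Sorted7 b) (hbj : InPolytope (shift b j)) (hj1 : 1 ≤ j) (hj7 : j ≤ 7)
    (hprime : p.Prime) (hp5 : 5 ≤ p) (hwin : (b 0 + 2 : ℤ) < (p : ℤ) ^ 2) (hP : (p : ℤ) ≤ b 7) (hQ : b 0 < (p : ℤ) + b 1 + b 6) (hQ7 : (p : ℤ) + b 1 + b 7 ≤ b 0) (hQ23 : (p : ℤ) + b 2 + b 3 ≤ b 0)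
    (hF1 : b 1 < 2 * (p : ℤ)) (hF2 : b 0 < 2 * (p : ℤ) + b 6 + b 7) (hd : 2 * (p : ℤ) ≤ dOf b) (hcas : casoratian b j ≠ 0) :
    (-8 : ℤ) ≤ padicValRat p (casoratian b j) := by
  haveI : Fact p.Prime := ⟨hprime⟩
  have hp2 : p % 2 = 1 := Nat.odd_iff.1 (hprime.odd_of_ne_two (by omega))
  obtain ⟨h21, h32, h43, h54, h65, h76⟩ := sorted7_chain hs
  obtain ⟨h0, hb1, hb2, hb3, hb4, -, -, -, -⟩ := box hb
  have hpb : (p : ℤ) ≤ b 0 := by linarith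
  have hT : ([1, -5, -5, 1] : List ℤ).reverse = [1, -5, -5, 1] := by decide
  have hdeg : (p : ℤ) * (((8 : ℕ) : ℤ) - 4) ≤ 2 * dOf b + 1 := by push_cast; linarith
  have hlong : ∀ i ∈ range 7, (p : ℤ) ≤ b (i + 1) := by
    intro i hi
    have hi7 := mem_range.1 hi
    interval_cases i <;> simp only [Nat.reduceAdd] <;> linarith
  rcases Int.emod_two_eq_zero_or_one (b 0) with hr | hr
  · have h := lawA5d8_of_cover hb hbj hj1 hj7 hprime hp5 hpb hwin hlong (cover16a_ev hb hs hP hQ hQ7 hQ23 hF1 hF2 hp5 hp2 hr) (M := 8)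
      (by norm_num) (by decide) hT (by rw [oddFlag_false hr]; decide) hdeg hcas
    simpa using h
  · have h := lawA5d8_of_cover hb hbj hj1 hj7 hprime hp5 hpb hwin hlong (cover16a_od hb hs hP hQ hQ7 hQ23 hF1 hF2 hp5 hp2 hr) (M := 8)
      (by norm_num) (by decide) hT (by rw [oddFlag_true hr]; decide) hdeg hcas
    simpa using h

end Bounds

/-! ## PATH accounting below `d = 3p` and (CV) on the whole profile -/

/-- **`PathAccountingFirstPeriod`'s conclusion on this `N_p = 16` profile (short blocks `(1,2), …, (1,6)`) below `d = 3p`, EVERY sorted `b`, every direction `j`.** -/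
theorem pathAccounting_profile16a (b : ℕ → ℤ) (j p : ℕ) (hb : InPolytope b) (hs : Sorted7 b) (hbj : InPolytope (shift b j))
    (hj1 : 1 ≤ j) (hj7 : j ≤ 7) (hprime : p.Prime) (hp5 : 5 ≤ p) (hwin : (b 0 + 2 : ℤ) < (p : ℤ) ^ 2) (hfp : FirstPeriod b p)
    (hP : (p : ℤ) ≤ b 7) (hQ : b 0 < (p : ℤ) + b 1 + b 6) (hQ7 : (p : ℤ) + b 1 + b 7 ≤ b 0) (hQ23 : (p : ℤ) + b 2 + b 3 ≤ b 0)
    (hd3 : dOf b < 3 * (p : ℤ)) (hcas : casoratian b j ≠ 0) :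
    dOf b / (p : ℤ) - pairFloors b p - min (if 2 ≤ dOf b / (p : ℤ) then (1 : ℤ) else 0) (5 - (cStar b p : ℤ))
      ≤ padicValRat p (casoratian b j) := by
  obtain ⟨hF1, hF2⟩ := fp_bounds hfp
  have hp0 : (0 : ℤ) < p := by exact_mod_cast hprime.pos
  rw [pairFloors_eq_16a hb hs hprime.pos hQ hQ7 hQ23 hfp]
  have hC11 : (cStar b p : ℤ) ≤ 11 := by exact_mod_cast cStar_le_eleven b p
  have hmin : -6 ≤ min (if 2 ≤ dOf b / (p : ℤ) then (1 : ℤ) else 0) (5 - (cStar b p : ℤ)) :=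
    le_min (by split_ifs <;> norm_num) (by linarith)
  have hfd3 : dOf b / (p : ℤ) < 3 := by rw [Int.ediv_lt_iff_lt_mul hp0]; linarith
  by_cases h2 : 2 * (p : ℤ) ≤ dOf b
  · linarith [cas_ge16a_neg8 hb hs hbj hj1 hj7 hprime hp5 hwin hP hQ hQ7 hQ23 hF1 hF2 h2 hcas]
  · push Not at h2
    have hfd : dOf b / (p : ℤ) < 2 := by rw [Int.ediv_lt_iff_lt_mul hp0]; linarith
    linarith [cas_ge16a_neg9 hb hs hbj hj1 hj7 hprime hp5 hwin hP hQ hQ7 hQ23 hF1 hF2 hcas]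

/-- **THE NODE ON THIS `N_p = 16` PROFILE BELOW `d = 3p`, EVERY SORTED `b`: `PathAccountingFirstPeriod` with its binders VERBATIM plus `p ≤ b₇`,
`b₀ < p + b₁ + b₆`, `p + b₁ + b₇ ≤ b₀`, `p + b₂ + b₃ ≤ b₀` and `d(b) < 3p`.** -/
theorem pathAccountingFirstPeriod_profile16a :
    ∀ (b : ℕ → ℤ) (p : ℕ), InPolytope b → Sorted7 b → InPolytope (shift b 7) →
      p.Prime → 5 ≤ p → (b 0 + 2 : ℤ) < (p : ℤ) ^ 2 → FirstPeriod b p →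
      (p : ℤ) ≤ b 7 → b 0 < (p : ℤ) + b 1 + b 6 → (p : ℤ) + b 1 + b 7 ≤ b 0 → (p : ℤ) + b 2 + b 3 ≤ b 0 → dOf b < 3 * (p : ℤ) →
      casoratian b 7 ≠ 0 →
        dOf b / (p : ℤ) - pairFloors b p - min (if 2 ≤ dOf b / (p : ℤ) then (1 : ℤ) else 0) (5 - (cStar b p : ℤ))
          ≤ padicValRat p (casoratian b 7) :=
  fun b p hb hs hb7 hprime hp5 hwin hfp hP hQ hQ7 hQ23 hd3 hcas =>
    pathAccounting_profile16a b 7 p hb hs hb7 (by norm_num) (by norm_num) hprime hp5 hwin hfp hP hQ hQ7 hQ23 hd3 hcas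

/-- **(CV) on the WHOLE profile, every sorted `b`, every `j`** (no hypothesis on `d`: `refund − N_p ≤ −15 ≤ −9`). -/
theorem profile16aCV (b : ℕ → ℤ) (j p : ℕ) (hb : InPolytope b) (hs : Sorted7 b) (hbj : InPolytope (shift b j))
    (hj1 : 1 ≤ j) (hj7 : j ≤ 7) (hprime : p.Prime) (hp5 : 5 ≤ p) (hwin : (b 0 + 2 : ℤ) < (p : ℤ) ^ 2) (hfp : FirstPeriod b p)
    (hP : (p : ℤ) ≤ b 7) (hQ : b 0 < (p : ℤ) + b 1 + b 6) (hQ7 : (p : ℤ) + b 1 + b 7 ≤ b 0) (hQ23 : (p : ℤ) + b 2 + b 3 ≤ b 0)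
    (hcas : casoratian b j ≠ 0) : refund b p - pairFloors b p ≤ padicValRat p (casoratian b j) := by
  obtain ⟨hF1, hF2⟩ := fp_bounds hfp
  rw [pairFloors_eq_16a hb hs hprime.pos hQ hQ7 hQ23 hfp]
  have hr : refund b p ≤ 1 := min_le_left _ _
  linarith [cas_ge16a_neg9 hb hs hbj hj1 hj7 hprime hp5 hwin hP hQ hQ7 hQ23 hF1 hF2 hcas]

end Summit.KontsevichZagierPeriods.Zeta5Search.FullProfile
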